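import Mathlib
import Literature.Probability.Percolation.PercolationProofs
import Literature.Probability.Percolation.ConditionalPositiveAssociation
import Literature.Probability.Percolation.ConditionalPositiveAssociationProofs
import Literature.Probability.Percolation.TwoClusterConditionalAssociation
import Literature.Probability.Percolation.TwoClusterConditionalAssociationProofs
import Summits.CriticalPhenomena.PercolationContinuityZ3.Theorems.PercNearOneGluingAdditiveGluingOffObserverFibres
import Summits.CriticalPhenomena.PercolationContinuityZ3.Theorems.PercNearOneGluingAdditiveGluingBlockPockets
import Summits.CriticalPhenomena.PercolationContinuityZ3.Theorems.PercNearOneGluingAdditiveGluingVariants1359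
import HarnessLib

/-! # Crux `PercNearOneGluing.AdditiveGluing` (stmt-CriticalPhenomena-4576), line `pocket-deficit-ratio` — the one-relay case

Support file for the line `pocket-deficit-ratio` (control-strategist seat; skeleton
`Cruxes/AdditiveGluing/Lines/pocket_deficit_ratio.lean`, stubs `stub_ratioMonotonePair` / `stub_ratioMonotone`); lands
`--supports stmt-CriticalPhenomena-4576`.  No definitions, no named facts.

## Content

`μ = prodBernoulli w`; vertices `a` (the designated relay), `s` (the observer), `v` (a bystander), `b` (the target).
`D = {a ↮ s}`; on `D`, "`a` wins" = `{a ↔ b}` and "`s` wins" = `{s ↔ b}`.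

* `ratioOneRelay_winner_attracts` (**the winner's cluster attracts the bystander**): `μ(D ∩ a↔b) · μ(D ∩ s↔b ∩ a↔v) ≤
  μ(D ∩ s↔b) · μ(D ∩ a↔b ∩ a↔v)`, i.e. `P(v ↔ a | s wins) ≤ P(v ↔ a | a wins)`.  Proof = Kozma–Nitzan's Lemma 1 twice, through
  `P(v ↔ a | a ↮ s)`: BHK 2006 Thm 1.3 for the cluster of `a` given `{a ↮ s}` with the increasing functions `1{b ∈ C_a}`,
  `1{v ∈ C_a}` (`P(v↔a | D) ≤ P(v↔a | D, a↔b)`), and BHK 2006 Thm 1.4 (negative correlation of `C_s` and `C_a` given `{s ↮ a}`)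
  with `1{b ∈ C_s}`, `1{v ∈ C_a}` (`P(v↔a | D, s↔b) ≤ P(v↔a | D)`).
* `winsDominate_hijack_le` / `winsDominate` (**the master inequality G — wins dominate every antitone losing-side functional**):
  for any antitone `η ≥ 0` on vertex sets vanishing on sets containing `a`, `WIN(S)·E[η(C(s))] ≥ WIN(s)·E[η(C(S))]` for `S = {s, v}`;
  its point form `μ(s↔b, a↮s, v↔a)·E[η(C(s))] ≤ μ(s↔b, a↮s)·E[η(C(s)); v↔a]`.  Same two BHK steps with `1{v ∈ C_a}` against `η(V(C_s))`.
* `winsDominate_pockets` (**`Λ(ζ) ≥ 0` in the syntax of the line's stubs**): `WIN(s)·Z(S) ≤ WIN(S)·Z(s)` for `S = {s, v}`, `Z` the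
  dead-pocket mass with worst selection (`Finset.inf'` product form) — pockets drop at least as fast as wins.
* `ratioMonotonePair_oneRelay` (**the line's stub `stub_ratioMonotonePair` at one relay, in its exact syntax**): for `A = {b, a₀}`,
  a 2-block `S ∋ s` disjoint from `A`: `K(s)·Z(S) ≤ K(S)·Z(s)` (no minimiser / badness hypothesis needed at one relay).
* `ratioOneRelay_odds` (**one-relay ratio monotonicity**): for the block `S = {s, v}`,
  `μ(S↔b, a↮S) · μ(a↔b, s↮b) ≥ μ(s↔b, a↮s) · μ(a↔b, S↮b)` — gluing a bystander onto the observer does not lower the odds of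
  beating the designated relay.  With one relay (`A = {b, a}`) this is exactly the line's stub `K(S)·Z(s) ≥ K(s)·Z(S)`
  (`K = WIN`, `Z = LOSE` there); it is the penalty-free part `M₁ ≥ 0` of the stub for every relay set.
[cite: VandenbergHaggstromKahn2005, Thm. 1.3 (p. 6), Thm. 1.4 (p. 7); KozmaNitzan2024, Lemma 1 (pp. 5–6), §3.2 pp. 12–14]
-/

namespace Summit.CriticalPhenomena.PercolationContinuityZ3.Theorems

open MeasureTheory Set
open Literature.Probability.LatticeModels (prodBernoulli)
open Literature.Probability.Percolation

noncomputable section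
open Classical

section RatioOneRelay

variable {n : ℕ}

/-- The vertex-hitting indicator `C ↦ 1{t = x ∨ t ∈ V(C)}` is monotone in the edge set. [folklore] -/
theorem ratioOneRelay_hit_mono (x t : Fin n) :
    Monotone fun C : Set (Sym2 (Fin n)) => (if (t = x ∨ ∃ e ∈ C, t ∈ e) then (1 : ℝ) else 0) := by
  intro C C' h
  by_cases hC : (t = x ∨ ∃ e ∈ C, t ∈ e)
  · have hC' : (t = x ∨ ∃ e ∈ C', t ∈ e) := by
      rcases hC with ht | ⟨e, he, hte⟩
      · exact Or.inl ht
      · exact Or.inr ⟨e, h he, hte⟩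
    simp only [hC, hC', if_true, le_refl]
  · simp only [hC, if_false]
    split_ifs <;> norm_num

/-- On the open edge cluster of `x`, the hitting indicator of `t` is the indicator of `{x ↔ t}`. [folklore] -/
theorem ratioOneRelay_hit_apply (x t : Fin n) (ω : BondConfig (Fin n)) :
    (if (t = x ∨ ∃ e ∈ openEdgeCluster ω x, t ∈ e) then (1 : ℝ) else 0) =
      (openConn x t : Set (BondConfig (Fin n))).indicator 1 ω := by
  by_cases h : (openGraph ω).Reachable x t
  · rw [if_pos ((reachable_iff_exists_mem_openEdgeCluster ω x t).1 h),
      Set.indicator_of_mem (show ω ∈ openConn x t from h), Pi.one_apply]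
  · rw [if_neg (fun h' => h ((reachable_iff_exists_mem_openEdgeCluster ω x t).2 h')),
      Set.indicator_of_notMem (show ω ∉ openConn x t from h)]

/-- Set integral of an indicator: `∫_D 1_E dμ = μ(D ∩ E)` (everything is measurable on the finite configuration space).
[folklore] -/
theorem ratioOneRelay_setIntegral_indicator (w : Sym2 (Fin n) → unitInterval) (D E : Set (BondConfig (Fin n))) :
    ∫ ω in D, E.indicator (1 : BondConfig (Fin n) → ℝ) ω ∂(prodBernoulli w) = (prodBernoulli w).real (D ∩ E) := by
  rw [integral_indicator_one (MeasurableSet.of_discrete), measureReal_restrict_apply (MeasurableSet.of_discrete),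
    Set.inter_comm]

/-- Set integral of a product of two indicators. [folklore] -/
theorem ratioOneRelay_setIntegral_indicator_mul (w : Sym2 (Fin n) → unitInterval)
    (D E E' : Set (BondConfig (Fin n))) :
    ∫ ω in D, E.indicator (1 : BondConfig (Fin n) → ℝ) ω * E'.indicator (1 : BondConfig (Fin n) → ℝ) ω
        ∂(prodBernoulli w) = (prodBernoulli w).real (D ∩ E ∩ E') := by
  have h : ∀ ω : BondConfig (Fin n), E.indicator (1 : BondConfig (Fin n) → ℝ) ω * E'.indicator 1 ω =
      (E ∩ E').indicator (1 : BondConfig (Fin n) → ℝ) ω := by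
    intro ω
    rw [← Set.indicator_indicator]
    by_cases hE : ω ∈ E
    · rw [Set.indicator_of_mem hE, Set.indicator_of_mem hE, Pi.one_apply, one_mul]
    · rw [Set.indicator_of_notMem hE, Set.indicator_of_notMem hE, zero_mul]
  simp_rw [h]
  rw [ratioOneRelay_setIntegral_indicator, Set.inter_assoc]

/-- **The winner's cluster attracts the bystander** (KN Lemma 1 twice): with `D = {a ↮ s}`,
`μ(D ∩ a↔b) · μ(D ∩ s↔b ∩ a↔v) ≤ μ(D ∩ s↔b) · μ(D ∩ a↔b ∩ a↔v)`.
[cite: VandenbergHaggstromKahn2005, Thm. 1.3 (p. 6), Thm. 1.4 (p. 7); KozmaNitzan2024, Lemma 1 (pp. 5–6)] -/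
theorem ratioOneRelay_winner_attracts (w : Sym2 (Fin n) → unitInterval) (a s v b : Fin n) (has : a ≠ s) :
    (prodBernoulli w).real ((openConn a s)ᶜ ∩ openConn a b)
        * (prodBernoulli w).real ((openConn a s)ᶜ ∩ openConn s b ∩ openConn a v) ≤
      (prodBernoulli w).real ((openConn a s)ᶜ ∩ openConn s b)
        * (prodBernoulli w).real ((openConn a s)ᶜ ∩ openConn a b ∩ openConn a v) := by
  -- the two conditioning sets of BHK are both `{a ↮ s}`
  have hD1 : {ω : BondConfig (Fin n) | ∀ x ∈ ({s} : Set (Fin n)), ¬ (openGraph ω).Reachable a x} =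
      (openConn a s : Set (BondConfig (Fin n)))ᶜ := by
    ext ω
    simp only [Set.mem_setOf_eq, Set.mem_singleton_iff, forall_eq, Set.mem_compl_iff]
    rfl
  have hD2 : {ω : BondConfig (Fin n) | ¬ (openGraph ω).Reachable s a} =
      (openConn a s : Set (BondConfig (Fin n)))ᶜ := by
    ext ω
    simp only [Set.mem_setOf_eq, Set.mem_compl_iff]
    rw [show (ω ∈ openConn a s ↔ (openGraph ω).Reachable a s) from Iff.rfl]
    exact ⟨fun h h' => h h'.symm, fun h h' => h h'.symm⟩
  set D : Set (BondConfig (Fin n)) := (openConn a s)ᶜ with hD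
  -- Step A: BHK Thm 1.3 for the cluster of `a` given `{a ↮ s}`, functions `1{b ∈ C_a}`, `1{v ∈ C_a}`
  have hA := BHK2006_clusterConditionalPositiveAssociation_holds (Fin n) w a ({s} : Set (Fin n))
    (fun C => if (b = a ∨ ∃ e ∈ C, b ∈ e) then (1 : ℝ) else 0)
    (fun C => if (v = a ∨ ∃ e ∈ C, v ∈ e) then (1 : ℝ) else 0)
    (ratioOneRelay_hit_mono a b) (ratioOneRelay_hit_mono a v) (by simpa using has)
  rw [hD1] at hA
  simp only [ratioOneRelay_hit_apply] at hA
  rw [ratioOneRelay_setIntegral_indicator, ratioOneRelay_setIntegral_indicator,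
    ratioOneRelay_setIntegral_indicator_mul] at hA
  -- Step B: BHK Thm 1.4 for the clusters of `s` and `a` given `{s ↮ a}`, functions `1{b ∈ C_s}`, `1{v ∈ C_a}`
  have hB := BHK2006_twoClusterConditionalAssociation_holds.negCorrelation (Fin n) w s a
    (fun C => if (b = s ∨ ∃ e ∈ C, b ∈ e) then (1 : ℝ) else 0)
    (fun C => if (v = a ∨ ∃ e ∈ C, v ∈ e) then (1 : ℝ) else 0)
    (ratioOneRelay_hit_mono s b) (ratioOneRelay_hit_mono a v) (Ne.symm has)
  rw [hD2] at hB
  simp only [ratioOneRelay_hit_apply] at hB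
  rw [ratioOneRelay_setIntegral_indicator, ratioOneRelay_setIntegral_indicator,
    ratioOneRelay_setIntegral_indicator_mul] at hB
  -- algebra: d·A_bv ≥ A_b·A_v and d·S_bv ≤ S_b·A_v give d·(A_b S_bv) ≤ d·(S_b A_bv); then cancel d (or everything is 0)
  set d := (prodBernoulli w).real D with hd
  set Ab := (prodBernoulli w).real (D ∩ openConn a b) with hAb
  set Av := (prodBernoulli w).real (D ∩ openConn a v) with hAv
  set Abv := (prodBernoulli w).real (D ∩ openConn a b ∩ openConn a v) with hAbv
  set Sb := (prodBernoulli w).real (D ∩ openConn s b) with hSb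
  set Sbv := (prodBernoulli w).real (D ∩ openConn s b ∩ openConn a v) with hSbv
  have hAb0 : 0 ≤ Ab := measureReal_nonneg
  have hSb0 : 0 ≤ Sb := measureReal_nonneg
  have hAbv0 : 0 ≤ Abv := measureReal_nonneg
  have hSbv0 : 0 ≤ Sbv := measureReal_nonneg
  have hAb_le : Ab ≤ d := measureReal_mono Set.inter_subset_left (measure_ne_top _ _)
  have hSbv_le : Sbv ≤ d :=
    measureReal_mono (Set.inter_subset_left.trans Set.inter_subset_left) (measure_ne_top _ _)
  have h1 : d * (Ab * Sbv) ≤ Ab * (Sb * Av) := by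
    have := mul_le_mul_of_nonneg_left hB hAb0
    linarith
  have h2 : Ab * (Sb * Av) ≤ d * (Sb * Abv) := by
    have := mul_le_mul_of_nonneg_left hA hSb0
    linarith
  by_cases hd0 : d = 0
  · have hAb' : Ab = 0 := le_antisymm (hd0 ▸ hAb_le) hAb0
    rw [hAb', zero_mul]
    exact mul_nonneg hSb0 hAbv0
  · have hdpos : 0 < d := lt_of_le_of_ne measureReal_nonneg (Ne.symm hd0)
    exact le_of_mul_le_mul_left (h1.trans h2) hdpos

/-- `{x ↔ b} ∩ {y ↮ b} = {x ↮ y} ∩ {x ↔ b}`: the winner/loser event in conditional form. [folklore] -/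
theorem ratioOneRelay_win_eq (x y b : Fin n) :
    (openConn x b : Set (BondConfig (Fin n))) ∩ (openConn y b)ᶜ = (openConn x y)ᶜ ∩ openConn x b := by
  ext ω
  simp only [Set.mem_inter_iff, Set.mem_compl_iff]
  constructor
  · rintro ⟨hxb, hyb⟩
    exact ⟨fun hxy => hyb ((SimpleGraph.Reachable.symm hxy).trans hxb), hxb⟩
  · rintro ⟨hxy, hxb⟩
    exact ⟨hxb, fun hyb => hxy (hxb.trans (SimpleGraph.Reachable.symm hyb))⟩

/-- **One-relay ratio monotonicity** (the line's stub with `A = {b, a}`, and the penalty-free part of it in general):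
for the block `S = {s, v}`,  `μ(s↔b, a↮s) · μ(a↔b, s↮b, v↮b) ≤ μ((s↔b ∨ v↔b), a↮s, a↮v) · μ(a↔b, s↮b)` —
the odds of beating the designated relay do not decrease when a bystander is glued onto the observer.  Proof: the
identity `WIN_S·LOSE_s − WIN_s·LOSE_S = [S1 margin] + μ(fresh win)·LOSE_s` and `ratioOneRelay_winner_attracts`.
[cite: KozmaNitzan2024, §3.2 pp. 12–14, Lemma 1 (pp. 5–6); VandenbergHaggstromKahn2005, Thms. 1.3–1.4 (pp. 6–7)] -/
theorem ratioOneRelay_odds (w : Sym2 (Fin n) → unitInterval) (a s v b : Fin n) (has : a ≠ s) :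
    (prodBernoulli w).real (openConn s b ∩ (openConn a s)ᶜ)
        * (prodBernoulli w).real (openConn a b ∩ (openConn s b)ᶜ ∩ (openConn v b)ᶜ) ≤
      (prodBernoulli w).real ((openConn s b ∪ openConn v b) ∩ (openConn a s)ᶜ ∩ (openConn a v)ᶜ)
        * (prodBernoulli w).real (openConn a b ∩ (openConn s b)ᶜ) := by
  have hW := ratioOneRelay_winner_attracts w a s v b has
  -- names
  set D : Set (BondConfig (Fin n)) := (openConn a s)ᶜ with hD
  have hE1 : (openConn s b : Set (BondConfig (Fin n))) ∩ (openConn a s)ᶜ = D ∩ openConn s b := Set.inter_comm _ _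
  have hE2 : (openConn a b : Set (BondConfig (Fin n))) ∩ (openConn s b)ᶜ = D ∩ openConn a b :=
    ratioOneRelay_win_eq a s b
  -- split `a wins` by the bystander reaching `b` (⟺ reaching `a` on `{a ↔ b}`)
  have hsplit : (prodBernoulli w).real (openConn a b ∩ (openConn s b)ᶜ ∩ (openConn v b)ᶜ) =
      (prodBernoulli w).real (D ∩ openConn a b) - (prodBernoulli w).real (D ∩ openConn a b ∩ openConn a v) := by
    rw [hE2]
    have h := measureReal_inter_add_sdiff (μ := prodBernoulli w) (s := D ∩ openConn a b)
      (MeasurableSet.of_discrete (s := (openConn a v : Set (BondConfig (Fin n)))))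
    have hdiff : (D ∩ openConn a b) \ (openConn a v : Set (BondConfig (Fin n))) =
        D ∩ openConn a b ∩ (openConn v b)ᶜ := by
      ext ω
      simp only [Set.mem_sdiff, Set.mem_inter_iff, Set.mem_compl_iff]
      constructor
      · rintro ⟨⟨hD', hab⟩, hav⟩
        exact ⟨⟨hD', hab⟩, fun hvb => hav (hab.trans (SimpleGraph.Reachable.symm hvb))⟩
      · rintro ⟨⟨hD', hab⟩, hvb⟩
        exact ⟨⟨hD', hab⟩, fun hav => hvb ((SimpleGraph.Reachable.symm hav).trans hab)⟩
    rw [hdiff] at h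
    linarith
  -- split `S wins` into `s wins without hijack` and the fresh wins of `v`
  have hwin : (prodBernoulli w).real ((openConn s b ∪ openConn v b) ∩ (openConn a s)ᶜ ∩ (openConn a v)ᶜ) =
      (prodBernoulli w).real (D ∩ openConn s b) - (prodBernoulli w).real (D ∩ openConn s b ∩ openConn a v)
        + (prodBernoulli w).real ((openConn v b : Set (BondConfig (Fin n))) ∩ (openConn s b)ᶜ ∩ D ∩ (openConn a v)ᶜ) := by
    have h1 := measureReal_inter_add_sdiff (μ := prodBernoulli w) (s := D ∩ openConn s b)
      (MeasurableSet.of_discrete (s := (openConn a v : Set (BondConfig (Fin n)))))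
    have hdisj : Disjoint ((D ∩ openConn s b) \ (openConn a v : Set (BondConfig (Fin n))))
        ((openConn v b : Set (BondConfig (Fin n))) ∩ (openConn s b)ᶜ ∩ D ∩ (openConn a v)ᶜ) := by
      rw [Set.disjoint_left]
      rintro ω ⟨⟨-, hsb⟩, -⟩ ⟨⟨⟨-, hsb'⟩, -⟩, -⟩
      exact hsb' hsb
    have hunion : ((D ∩ openConn s b) \ (openConn a v : Set (BondConfig (Fin n)))) ∪
        ((openConn v b : Set (BondConfig (Fin n))) ∩ (openConn s b)ᶜ ∩ D ∩ (openConn a v)ᶜ) =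
        (openConn s b ∪ openConn v b) ∩ (openConn a s)ᶜ ∩ (openConn a v)ᶜ := by
      ext ω
      simp only [Set.mem_union, Set.mem_sdiff, Set.mem_inter_iff, Set.mem_compl_iff, hD]
      constructor
      · rintro (⟨⟨hD', hsb⟩, hav⟩ | ⟨⟨⟨hvb, -⟩, hD'⟩, hav⟩)
        · exact ⟨⟨Or.inl hsb, hD'⟩, hav⟩
        · exact ⟨⟨Or.inr hvb, hD'⟩, hav⟩
      · rintro ⟨⟨hsb | hvb, hD'⟩, hav⟩
        · exact Or.inl ⟨⟨hD', hsb⟩, hav⟩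
        · by_cases hsb : ω ∈ openConn s b
          · exact Or.inl ⟨⟨hD', hsb⟩, hav⟩
          · exact Or.inr ⟨⟨⟨hvb, hsb⟩, hD'⟩, hav⟩
    have h2 := measureReal_union (μ := prodBernoulli w) hdisj (MeasurableSet.of_discrete)
    rw [hunion] at h2
    linarith
  have hfresh : 0 ≤ (prodBernoulli w).real ((openConn v b : Set (BondConfig (Fin n))) ∩ (openConn s b)ᶜ ∩ D ∩ (openConn a v)ᶜ) :=
    measureReal_nonneg
  have hAb0 : 0 ≤ (prodBernoulli w).real (D ∩ openConn a b) := measureReal_nonneg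
  rw [hE1, hsplit, hwin, hE2]
  nlinarith [hW, hfresh, hAb0]

/-! ### The master inequality: wins dominate every antitone losing-side functional -/

/-- Off `{a ↮ s}` an `a`-vanishing function of the cluster of `s` vanishes, so its set integral over `{a ↮ s} ∩ E` is its
set integral over `E`. [folklore] -/
theorem winsDominate_setIntegral_inter_eq (w : Sym2 (Fin n) → unitInterval) (a s : Fin n) (η : Finset (Fin n) → ℝ)
    (hηa : ∀ T : Finset (Fin n), a ∈ T → η T = 0) (E : Set (BondConfig (Fin n))) :
    ∫ ω in (openConn a s : Set (BondConfig (Fin n)))ᶜ ∩ E,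
        η (Finset.univ.filter fun x : Fin n => x ∈ openCluster ω s) ∂(prodBernoulli w) =
      ∫ ω in E, η (Finset.univ.filter fun x : Fin n => x ∈ openCluster ω s) ∂(prodBernoulli w) := by
  rw [← integral_indicator (MeasurableSet.of_discrete), ← integral_indicator (MeasurableSet.of_discrete)]
  refine integral_congr_ae (Filter.Eventually.of_forall fun ω => ?_)
  by_cases hE : ω ∈ E
  · by_cases hD : ω ∈ (openConn a s : Set (BondConfig (Fin n)))ᶜ
    · rw [Set.indicator_of_mem (Set.mem_inter hD hE), Set.indicator_of_mem hE]
    · rw [Set.indicator_of_notMem (fun h => hD h.1), Set.indicator_of_mem hE]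
      refine (hηa _ ?_).symm
      simp only [Finset.mem_filter, Finset.mem_univ, true_and]
      have h : (openGraph ω).Reachable a s := not_not.1 hD
      exact h.symm
  · rw [Set.indicator_of_notMem (fun h => hE h.2), Set.indicator_of_notMem hE]

/-- **Wins dominate the losing side, point form (the exchange lemma behind ratio monotonicity).**  For vertices `a ≠ s`, a
bystander `v`, the target `b`, and ANY antitone `η ≥ 0` on vertex sets vanishing on sets containing `a`:
`μ(s↔b, a↮s, v↔a) · E[η(C(s))] ≤ μ(s↔b, a↮s) · E[η(C(s)); v↔a]` — "given that `s` beats `a`, the bystander is hijacked by `a` at most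
as often as it is in any `η`-weighted losing configuration".  Proof: BHK 1.4 (`1{b ∈ C_s}` vs `1{v ∈ C_a}` given `s ↮ a`) and BHK's two-cluster
theorem (`1{v ∈ C_a}` increasing in `C_a`, `η(V(C_s))` antitone in `C_s`, given `a ↮ s`), chained through `P(v ↔ a | a ↮ s)`.
[cite: VandenbergHaggstromKahn2005, Thm. 1.4–1.5 (p. 7); KozmaNitzan2024, Lemma 1 (pp. 5–6)] -/
theorem winsDominate_hijack_le (w : Sym2 (Fin n) → unitInterval) (a s v b : Fin n) (has : a ≠ s)
    (η : Finset (Fin n) → ℝ) (hη : Antitone η) (hη0 : ∀ T, 0 ≤ η T) (hηa : ∀ T : Finset (Fin n), a ∈ T → η T = 0) :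
    (prodBernoulli w).real ((openConn a s)ᶜ ∩ openConn s b ∩ openConn a v)
        * ∫ ω, η (Finset.univ.filter fun x : Fin n => x ∈ openCluster ω s) ∂(prodBernoulli w) ≤
      (prodBernoulli w).real ((openConn a s)ᶜ ∩ openConn s b)
        * ∫ ω in (openConn a v : Set (BondConfig (Fin n))),
            η (Finset.univ.filter fun x : Fin n => x ∈ openCluster ω s) ∂(prodBernoulli w) := by
  have hD1 : {ω : BondConfig (Fin n) | ¬ (openGraph ω).Reachable s a} =
      (openConn a s : Set (BondConfig (Fin n)))ᶜ := by
    ext ω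
    simp only [Set.mem_setOf_eq, Set.mem_compl_iff]
    rw [show (ω ∈ openConn a s ↔ (openGraph ω).Reachable a s) from Iff.rfl]
    exact ⟨fun h h' => h h'.symm, fun h h' => h h'.symm⟩
  have hD2 : {ω : BondConfig (Fin n) | ¬ (openGraph ω).Reachable a s} =
      (openConn a s : Set (BondConfig (Fin n)))ᶜ := rfl
  set D : Set (BondConfig (Fin n)) := (openConn a s)ᶜ with hD
  -- (1) BHK Thm 1.4: `1{b ∈ C_s}` and `1{v ∈ C_a}` are negatively correlated given `{s ↮ a}`
  have hB := BHK2006_twoClusterConditionalAssociation_holds.negCorrelation (Fin n) w s a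
    (fun C => if (b = s ∨ ∃ e ∈ C, b ∈ e) then (1 : ℝ) else 0)
    (fun C => if (v = a ∨ ∃ e ∈ C, v ∈ e) then (1 : ℝ) else 0)
    (ratioOneRelay_hit_mono s b) (ratioOneRelay_hit_mono a v) (Ne.symm has)
  rw [hD1] at hB
  simp only [ratioOneRelay_hit_apply] at hB
  rw [ratioOneRelay_setIntegral_indicator, ratioOneRelay_setIntegral_indicator,
    ratioOneRelay_setIntegral_indicator_mul] at hB
  -- (2) BHK two-cluster theorem for the pair `(a, s)`: `1{v ∈ C_a}` (increasing in `C_a`) and `η(V(C_s))` (antitone in `C_s`)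
  have hT := BHK2006_twoClusterConditionalAssociation_holds (Fin n) w a s
    (fun C _ => if (v = a ∨ ∃ e ∈ C, v ∈ e) then (1 : ℝ) else 0)
    (fun _ C' => η (Finset.univ.filter fun x : Fin n => x = s ∨ ∃ e ∈ C', x ∈ e))
    (fun _ => ratioOneRelay_hit_mono a v) (fun _ => antitone_const)
    (fun _ => monotone_const) (fun _ => hη.comp_monotone (offObs_vertF_mono s)) has
  rw [hD2] at hT
  simp only [ratioOneRelay_hit_apply, offObs_vertF_openEdgeCluster] at hT
  rw [ratioOneRelay_setIntegral_indicator] at hT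
  -- the `η`-integrals over `D` are the full integrals (η vanishes off `D`)
  have hI1 : ∫ ω in D, η (Finset.univ.filter fun x : Fin n => x ∈ openCluster ω s) ∂(prodBernoulli w) =
      ∫ ω, η (Finset.univ.filter fun x : Fin n => x ∈ openCluster ω s) ∂(prodBernoulli w) := by
    have h := winsDominate_setIntegral_inter_eq w a s η hηa Set.univ
    rwa [Set.inter_univ, Measure.restrict_univ] at h
  have hI2 : ∫ ω in D, (openConn a v : Set (BondConfig (Fin n))).indicator 1 ω *
        η (Finset.univ.filter fun x : Fin n => x ∈ openCluster ω s) ∂(prodBernoulli w) =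
      ∫ ω in (openConn a v : Set (BondConfig (Fin n))),
        η (Finset.univ.filter fun x : Fin n => x ∈ openCluster ω s) ∂(prodBernoulli w) := by
    have h := winsDominate_setIntegral_inter_eq w a s η hηa (openConn a v)
    rw [← hD] at h
    have hprod : (fun ω : BondConfig (Fin n) => (openConn a v : Set (BondConfig (Fin n))).indicator
        (1 : BondConfig (Fin n) → ℝ) ω * η (Finset.univ.filter fun x : Fin n => x ∈ openCluster ω s)) =
        (openConn a v : Set (BondConfig (Fin n))).indicator
          (fun ω => η (Finset.univ.filter fun x : Fin n => x ∈ openCluster ω s)) := by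
      funext ω
      by_cases hω : ω ∈ (openConn a v : Set (BondConfig (Fin n)))
      · rw [Set.indicator_of_mem hω, Set.indicator_of_mem hω, Pi.one_apply, one_mul]
      · rw [Set.indicator_of_notMem hω, Set.indicator_of_notMem hω, zero_mul]
    rw [hprod, integral_indicator (MeasurableSet.of_discrete), Measure.restrict_restrict (MeasurableSet.of_discrete),
      Set.inter_comm, h]
  rw [hI1, hI2] at hT
  -- names and signs
  set d := (prodBernoulli w).real D with hd
  set Sb := (prodBernoulli w).real (D ∩ openConn s b) with hSb
  set Av := (prodBernoulli w).real (D ∩ openConn a v) with hAv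
  set H := (prodBernoulli w).real (D ∩ openConn s b ∩ openConn a v) with hH
  set I := ∫ ω, η (Finset.univ.filter fun x : Fin n => x ∈ openCluster ω s) ∂(prodBernoulli w) with hI
  set J := ∫ ω in (openConn a v : Set (BondConfig (Fin n))),
      η (Finset.univ.filter fun x : Fin n => x ∈ openCluster ω s) ∂(prodBernoulli w) with hJ
  have hI0 : 0 ≤ I := integral_nonneg fun ω => hη0 _
  have hJ0 : 0 ≤ J := setIntegral_nonneg (MeasurableSet.of_discrete) fun ω _ => hη0 _
  have hSb0 : 0 ≤ Sb := measureReal_nonneg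
  have hH0 : 0 ≤ H := measureReal_nonneg
  have hHle : H ≤ d := measureReal_mono (Set.inter_subset_left.trans Set.inter_subset_left) (measure_ne_top _ _)
  -- hB : d * H ≤ Sb * Av ;  hT : Av * I ≤ d * J
  have h1 : d * (H * I) ≤ Sb * (Av * I) := by
    have := mul_le_mul_of_nonneg_right hB hI0
    linarith
  have h2 : Sb * (Av * I) ≤ d * (Sb * J) := by
    have := mul_le_mul_of_nonneg_left hT hSb0
    linarith
  by_cases hd0 : d = 0
  · have hH' : H = 0 := le_antisymm (hd0 ▸ hHle) hH0
    rw [hH', zero_mul]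
    exact mul_nonneg hSb0 hJ0
  · have hdpos : 0 < d := lt_of_le_of_ne measureReal_nonneg (Ne.symm hd0)
    exact le_of_mul_le_mul_left (h1.trans h2) hdpos

/-- **Wins dominate the losing side (master inequality G, one bystander).**  For `a ≠ s`, `S = {s, v}`, and any antitone `η ≥ 0` on vertex
sets vanishing on sets containing `a`:  `WIN(S) · E[η(C(s))] ≥ WIN(s) · E[η(C(S))]`, where `WIN(X) = μ(X ↔ b, a ↮ X)` and `C(S) = C(s) ∪ C(v)`.
Instances: `η(W) = 1{b ∉ W} μ(a ↔ b in Wᶜ)` gives the one-relay ratio monotonicity `ratioOneRelay_odds`; `η(W) = 1{W ∩ A = ∅}·min_A μ(· ↔ b in Wᶜ)`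
gives `WIN(S)·Z(s) ≥ WIN(s)·Z(S)` (pockets drop at least as fast as wins) for the line's dead-pocket mass `Z`.
[cite: VandenbergHaggstromKahn2005, Thm. 1.4–1.5 (p. 7); KozmaNitzan2024, Lemma 1 (pp. 5–6), §3.2 pp. 12–14] -/
theorem winsDominate (w : Sym2 (Fin n) → unitInterval) (a s v b : Fin n) (has : a ≠ s)
    (η : Finset (Fin n) → ℝ) (hη : Antitone η) (hη0 : ∀ T, 0 ≤ η T) (hηa : ∀ T : Finset (Fin n), a ∈ T → η T = 0) :
    (prodBernoulli w).real (openConn s b ∩ (openConn a s)ᶜ)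
        * ∫ ω, η (Finset.univ.filter fun x : Fin n => x ∈ openCluster ω s ∨ x ∈ openCluster ω v) ∂(prodBernoulli w) ≤
      (prodBernoulli w).real ((openConn s b ∪ openConn v b) ∩ (openConn a s)ᶜ ∩ (openConn a v)ᶜ)
        * ∫ ω, η (Finset.univ.filter fun x : Fin n => x ∈ openCluster ω s) ∂(prodBernoulli w) := by
  have key := winsDominate_hijack_le w a s v b has η hη hη0 hηa
  -- WIN(S) ≥ WIN(s) − Hij
  have hWIN : (prodBernoulli w).real (openConn s b ∩ (openConn a s)ᶜ) ≤
      (prodBernoulli w).real ((openConn s b ∪ openConn v b) ∩ (openConn a s)ᶜ ∩ (openConn a v)ᶜ)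
        + (prodBernoulli w).real ((openConn a s)ᶜ ∩ openConn s b ∩ openConn a v) := by
    have hsub : (openConn s b : Set (BondConfig (Fin n))) ∩ (openConn a s)ᶜ ⊆
        ((openConn s b ∪ openConn v b) ∩ (openConn a s)ᶜ ∩ (openConn a v)ᶜ) ∪
          ((openConn a s)ᶜ ∩ openConn s b ∩ openConn a v) := by
      rintro ω ⟨hsb, has'⟩
      by_cases hav : ω ∈ (openConn a v : Set (BondConfig (Fin n)))
      · exact Or.inr ⟨⟨has', hsb⟩, hav⟩
      · exact Or.inl ⟨⟨Or.inl hsb, has'⟩, hav⟩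
    exact (measureReal_mono hsub (measure_ne_top _ _)).trans (measureReal_union_le _ _)
  -- E[η(C(S))] ≤ E[η(C(s))] − E[η(C(s)); v↔a]
  have hpt : ∀ ω : BondConfig (Fin n),
      η (Finset.univ.filter fun x : Fin n => x ∈ openCluster ω s ∨ x ∈ openCluster ω v) ≤
        η (Finset.univ.filter fun x : Fin n => x ∈ openCluster ω s)
          - (openConn a v : Set (BondConfig (Fin n))).indicator
              (fun ω => η (Finset.univ.filter fun x : Fin n => x ∈ openCluster ω s)) ω := by
    intro ω
    by_cases hav : ω ∈ (openConn a v : Set (BondConfig (Fin n)))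
    · rw [Set.indicator_of_mem hav, sub_self]
      refine le_of_eq (hηa _ ?_)
      simp only [Finset.mem_filter, Finset.mem_univ, true_and]
      exact Or.inr (show (openGraph ω).Reachable v a from (SimpleGraph.Reachable.symm hav))
    · rw [Set.indicator_of_notMem hav, sub_zero]
      refine hη ?_
      intro x hx
      simp only [Finset.mem_filter, Finset.mem_univ, true_and] at hx ⊢
      exact Or.inl hx
  have hint : ∫ ω, η (Finset.univ.filter fun x : Fin n => x ∈ openCluster ω s ∨ x ∈ openCluster ω v) ∂(prodBernoulli w) ≤
      ∫ ω, η (Finset.univ.filter fun x : Fin n => x ∈ openCluster ω s) ∂(prodBernoulli w)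
        - ∫ ω in (openConn a v : Set (BondConfig (Fin n))),
            η (Finset.univ.filter fun x : Fin n => x ∈ openCluster ω s) ∂(prodBernoulli w) := by
    rw [← integral_indicator (MeasurableSet.of_discrete), ← integral_sub (Integrable.of_finite) (Integrable.of_finite)]
    exact integral_mono (Integrable.of_finite) (Integrable.of_finite) hpt
  have hWs0 : 0 ≤ (prodBernoulli w).real (openConn s b ∩ (openConn a s)ᶜ) := measureReal_nonneg
  have hI0 : 0 ≤ ∫ ω, η (Finset.univ.filter fun x : Fin n => x ∈ openCluster ω s) ∂(prodBernoulli w) :=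
    integral_nonneg fun ω => hη0 _
  have hIS0 : 0 ≤ ∫ ω, η (Finset.univ.filter fun x : Fin n => x ∈ openCluster ω s ∨ x ∈ openCluster ω v) ∂(prodBernoulli w) :=
    integral_nonneg fun ω => hη0 _
  have hcomm : (prodBernoulli w).real ((openConn a s)ᶜ ∩ openConn s b) =
      (prodBernoulli w).real (openConn s b ∩ (openConn a s)ᶜ) := by
    rw [Set.inter_comm]
  rw [hcomm] at key
  nlinarith [key, hWIN, hint, hWs0, hI0, hIS0, mul_le_mul_of_nonneg_left hint hWs0]

/-! ### Corollary for the line's dead-pocket mass: `WIN(S)·Z(s) ≥ WIN(s)·Z(S)` -/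

/-- Finite-sum form of the integral of a function of a `Finset`-valued statistic. [folklore] -/
theorem ratioZeta_integral_eq_sum (w : Sym2 (Fin n) → unitInterval) (g : BondConfig (Fin n) → Finset (Fin n))
    (φ : Finset (Fin n) → ℝ) :
    ∫ ω, φ (g ω) ∂(prodBernoulli w) = ∑ T : Finset (Fin n), φ T * (prodBernoulli w).real {ω : BondConfig (Fin n) | g ω = T} := by
  have hpt : ∀ ω : BondConfig (Fin n), φ (g ω) =
      ∑ T : Finset (Fin n), ({ω : BondConfig (Fin n) | g ω = T}).indicator (fun _ => φ T) ω := by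
    intro ω
    rw [Finset.sum_eq_single (g ω)]
    · rw [Set.indicator_of_mem (show ω ∈ {ω' : BondConfig (Fin n) | g ω' = g ω} from rfl)]
    · intro T _ hT
      rw [Set.indicator_of_notMem]
      exact fun h => hT (Eq.symm h)
    · exact fun h => absurd (Finset.mem_univ _) h
  simp_rw [hpt]
  rw [integral_finsetSum]
  · refine Finset.sum_congr rfl fun T _ => ?_
    rw [integral_indicator MeasurableSet.of_discrete, setIntegral_const, smul_eq_mul, mul_comm]
  · intro T _
    exact (integrable_const _).indicator MeasurableSet.of_discrete

/-- `{x ↔ y in S}` is monotone in `S` (local copy of the folklore lemma). [folklore] -/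
theorem ratioZeta_openConnIn_mono {S S' : Set (Fin n)} (h : S ⊆ S') (x y : Fin n) :
    (openConnIn S x y : Set (BondConfig (Fin n))) ⊆ openConnIn S' x y := by
  rintro ω ⟨hx, hy, hr⟩
  exact ⟨h hx, h hy, hr.map (SimpleGraph.induceHomOfLE (G := openGraph ω) h).toHom⟩

/-- The line's pocket functional `ζ(T) = 1{T ∩ A = ∅} · min_{a ∈ A} μ(a ↔ b in Tᶜ)` is antitone in `T`. [folklore] -/
theorem ratioZeta_antitone (w : Sym2 (Fin n) → unitInterval) (A : Finset (Fin n)) (b : Fin n) (hb : b ∈ A) :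
    Antitone (fun T : Finset (Fin n) => if Disjoint T A then
      A.inf' ⟨b, hb⟩ (fun a => (prodBernoulli w).real (openConnIn ((T : Set (Fin n)))ᶜ a b)) else 0) := by
  intro T T' hTT'
  have hnn : ∀ U : Finset (Fin n), 0 ≤ A.inf' ⟨b, hb⟩
      (fun a => (prodBernoulli w).real (openConnIn ((U : Set (Fin n)))ᶜ a b)) :=
    fun U => Finset.le_inf' _ _ fun a _ => measureReal_nonneg
  by_cases hd' : Disjoint T' A
  · have hd : Disjoint T A := Finset.disjoint_of_subset_left hTT' hd'
    simp only [hd, hd', if_true]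
    refine Finset.le_inf' _ _ fun a ha => (Finset.inf'_le _ ha).trans ?_
    refine measureReal_mono (ratioZeta_openConnIn_mono ?_ a b) (measure_ne_top _ _)
    exact Set.compl_subset_compl.2 (Finset.coe_subset.2 hTT')
  · simp only [hd', if_false]
    split_ifs
    · exact hnn T
    · exact le_refl _

/-- The block-cluster event of the line's stubs, for the block `{s, v}`, is the fibre of the `Finset` statistic
`ω ↦ {x | x ∈ C(s) ∨ x ∈ C(v)}`. [folklore] -/
theorem ratioZeta_blockEvent_eq (s v : Fin n) (T : Finset (Fin n)) :
    {ω : BondConfig (Fin n) | ∀ z : Fin n, (z ∈ T ↔ ω ∈ ⋃ x ∈ ({s, v} : Finset (Fin n)), openConn x z)} =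
      {ω : BondConfig (Fin n) | (Finset.univ.filter fun x : Fin n => x ∈ openCluster ω s ∨ x ∈ openCluster ω v) = T} := by
  ext ω
  simp only [Set.mem_setOf_eq]
  constructor
  · intro h
    ext z
    simp only [Finset.mem_filter, Finset.mem_univ, true_and]
    rw [h z]
    simp only [Set.mem_iUnion, Finset.mem_insert, Finset.mem_singleton, exists_prop]
    constructor
    · rintro (hz | hz)
      · exact ⟨s, Or.inl rfl, hz⟩
      · exact ⟨v, Or.inr rfl, hz⟩
    · rintro ⟨x, (hx | hx), hz⟩
      · subst hx; exact Or.inl hz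
      · subst hx; exact Or.inr hz
  · intro h z
    rw [← h]
    simp only [Finset.mem_filter, Finset.mem_univ, true_and, Set.mem_iUnion, Finset.mem_insert, Finset.mem_singleton,
      exists_prop]
    constructor
    · rintro (hz | hz)
      · exact ⟨s, Or.inl rfl, hz⟩
      · exact ⟨v, Or.inr rfl, hz⟩
    · rintro ⟨x, (hx | hx), hz⟩
      · subst hx; exact Or.inl hz
      · subst hx; exact Or.inr hz

/-- **Pockets drop at least as fast as wins** (`Λ(ζ) ≥ 0`), in the syntax of the line's stubs for the block `S = {s, v}`:
`WIN(s) · Z(S) ≤ WIN(S) · Z(s)` with `Z` the dead-pocket mass with worst selection (`Finset.inf'` product form) and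
`WIN(X) = μ(X ↔ b, a₀ ↮ X)`.  Instance `η = ζ` of `winsDominate`. [cite: VandenbergHaggstromKahn2005, Thm. 1.4–1.5 (p. 7); KozmaNitzan2024, §3.2 pp. 12–14] -/
theorem winsDominate_pockets (w : Sym2 (Fin n) → unitInterval) (A : Finset (Fin n)) (b a₀ s v : Fin n)
    (hb : b ∈ A) (ha₀ : a₀ ∈ A) (has : a₀ ≠ s) :
    (prodBernoulli w).real (openConn s b ∩ (openConn a₀ s)ᶜ)
        * (∑ W ∈ (Finset.univ : Finset (Finset (Fin n))).filter (fun W => Disjoint W A),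
            (prodBernoulli w).real
                {ω : BondConfig (Fin n) | ∀ z : Fin n, (z ∈ W ↔ ω ∈ ⋃ x ∈ ({s, v} : Finset (Fin n)), openConn x z)}
              * A.inf' ⟨b, hb⟩ (fun a => (prodBernoulli w).real (openConnIn ((W : Set (Fin n)))ᶜ a b))) ≤
      (prodBernoulli w).real ((openConn s b ∪ openConn v b) ∩ (openConn a₀ s)ᶜ ∩ (openConn a₀ v)ᶜ)
        * (∑ W ∈ (Finset.univ : Finset (Finset (Fin n))).filter (fun W => s ∈ W ∧ Disjoint W A),
            (prodBernoulli w).real {ω : BondConfig (Fin n) | openCluster ω s = (W : Set (Fin n))}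
              * A.inf' ⟨b, hb⟩ (fun a => (prodBernoulli w).real (openConnIn ((W : Set (Fin n)))ᶜ a b))) := by
  set ζ : Finset (Fin n) → ℝ := fun T => if Disjoint T A then
      A.inf' ⟨b, hb⟩ (fun a => (prodBernoulli w).real (openConnIn ((T : Set (Fin n)))ᶜ a b)) else 0 with hζ
  have hnn : ∀ U : Finset (Fin n), 0 ≤ A.inf' ⟨b, hb⟩
      (fun a => (prodBernoulli w).real (openConnIn ((U : Set (Fin n)))ᶜ a b)) :=
    fun U => Finset.le_inf' _ _ fun a _ => measureReal_nonneg
  have hζ0 : ∀ T, 0 ≤ ζ T := fun T => by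
    simp only [hζ]
    split_ifs
    · exact hnn T
    · exact le_refl _
  have hζa : ∀ T : Finset (Fin n), a₀ ∈ T → ζ T = 0 := fun T hT => by
    simp only [hζ]
    rw [if_neg]
    exact fun hd => Finset.disjoint_left.1 hd hT ha₀
  have key := winsDominate w a₀ s v b has ζ (ratioZeta_antitone w A b hb) hζ0 hζa
  -- the two integrals as the sums of the statement
  have hS : ∫ ω, ζ (Finset.univ.filter fun x : Fin n => x ∈ openCluster ω s ∨ x ∈ openCluster ω v) ∂(prodBernoulli w) =
      ∑ W ∈ (Finset.univ : Finset (Finset (Fin n))).filter (fun W => Disjoint W A),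
        (prodBernoulli w).real
            {ω : BondConfig (Fin n) | ∀ z : Fin n, (z ∈ W ↔ ω ∈ ⋃ x ∈ ({s, v} : Finset (Fin n)), openConn x z)}
          * A.inf' ⟨b, hb⟩ (fun a => (prodBernoulli w).real (openConnIn ((W : Set (Fin n)))ᶜ a b)) := by
    rw [ratioZeta_integral_eq_sum, Finset.sum_filter]
    refine Finset.sum_congr rfl fun T _ => ?_
    rw [ratioZeta_blockEvent_eq]
    simp only [hζ]
    split_ifs
    · ring
    · rw [zero_mul]
  have hs : ∫ ω, ζ (Finset.univ.filter fun x : Fin n => x ∈ openCluster ω s) ∂(prodBernoulli w) =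
      ∑ W ∈ (Finset.univ : Finset (Finset (Fin n))).filter (fun W => s ∈ W ∧ Disjoint W A),
        (prodBernoulli w).real {ω : BondConfig (Fin n) | openCluster ω s = (W : Set (Fin n))}
          * A.inf' ⟨b, hb⟩ (fun a => (prodBernoulli w).real (openConnIn ((W : Set (Fin n)))ᶜ a b)) := by
    rw [ratioZeta_integral_eq_sum, Finset.sum_filter]
    refine Finset.sum_congr rfl fun T _ => ?_
    have hfib : {ω : BondConfig (Fin n) | (Finset.univ.filter fun x : Fin n => x ∈ openCluster ω s) = T} =
        {ω : BondConfig (Fin n) | openCluster ω s = (T : Set (Fin n))} := by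
      ext ω
      exact (offObs_mem_fib_iff s T ω).symm
    rw [hfib]
    by_cases hsT : s ∈ T
    · simp only [hζ, hsT, true_and]
      split_ifs
      · ring
      · rw [zero_mul]
    · have hempty : {ω : BondConfig (Fin n) | openCluster ω s = (T : Set (Fin n))} = ∅ := by
        ext ω
        simp only [Set.mem_setOf_eq, Set.mem_empty_iff_false, iff_false]
        intro h
        apply hsT
        rw [← Finset.mem_coe, ← h]
        exact (SimpleGraph.Reachable.refl s : (openGraph ω).Reachable s s)
      rw [hempty, measureReal_empty, mul_zero]
      simp only [hsT, false_and, if_false, zero_mul]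
  rw [hS, hs] at key
  exact key

/-! ### The stub `stub_ratioMonotonePair` at ONE relay (`A = {b, a₀}`), in its exact syntax -/

/-- For a pocket `W` avoiding `{b, a₀}` the worst selection over `{b, a₀}` is `a₀`:
`inf'_{a ∈ {b,a₀}} μ(a ↔ b in Wᶜ) = μ(a₀ ↔ b in Wᶜ)` (the `b`-term is `1`). [folklore] -/
theorem ratioOneRelay_inf'_pair (u : Sym2 (Fin n) → unitInterval) (b a₀ : Fin n) (W : Finset (Fin n))
    (hW : Disjoint W ({b, a₀} : Finset (Fin n))) (hb : b ∈ ({b, a₀} : Finset (Fin n))) :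
    ({b, a₀} : Finset (Fin n)).inf' ⟨b, hb⟩
        (fun a => (prodBernoulli u).real (openConnIn ((W : Set (Fin n)))ᶜ a b)) =
      (prodBernoulli u).real (openConnIn ((W : Set (Fin n)))ᶜ a₀ b) := by
  have hbW : b ∉ W := fun h => Finset.disjoint_left.1 hW h (Finset.mem_insert_self b _)
  have hbb : (prodBernoulli u).real (openConnIn ((W : Set (Fin n)))ᶜ b b) = 1 := by
    have huniv : (openConnIn ((W : Set (Fin n)))ᶜ b b : Set (BondConfig (Fin n))) = Set.univ := by
      refine Set.eq_univ_of_forall fun ω => ?_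
      have hbc : b ∈ ((W : Set (Fin n)))ᶜ := fun h => hbW (Finset.mem_coe.1 h)
      exact ⟨hbc, hbc, SimpleGraph.Reachable.refl _⟩
    rw [huniv, probReal_univ]
  refine le_antisymm (Finset.inf'_le _ (by simp)) (Finset.le_inf' _ _ fun a ha => ?_)
  rcases Finset.mem_insert.1 ha with rfl | ha'
  · rw [hbb]
    exact measureReal_le_one
  · rw [Finset.mem_singleton.1 ha']

/-- The block's dead-pocket mass at one relay is the losing mass:
`Σ_{W ∩ {b,a₀} = ∅} μ(K_S = W) · inf' = μ(a₀ ↔ b, S ↮ b, S ↮ a₀)`. [folklore; KozmaNitzan2024 §3.2 p. 14 (pocket Markov)] -/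
theorem ratioOneRelay_blockPockets_eq (u : Sym2 (Fin n) → unitInterval) (S : Finset (Fin n)) (hS : S.Nonempty)
    (b a₀ : Fin n) (hb : b ∈ ({b, a₀} : Finset (Fin n))) :
    ∑ W ∈ (Finset.univ : Finset (Finset (Fin n))).filter (fun W => Disjoint W ({b, a₀} : Finset (Fin n))),
        (prodBernoulli u).real {ω : BondConfig (Fin n) | ∀ z : Fin n, (z ∈ W ↔ ω ∈ ⋃ x ∈ S, openConn x z)}
          * ({b, a₀} : Finset (Fin n)).inf' ⟨b, hb⟩
              (fun a => (prodBernoulli u).real (openConnIn ((W : Set (Fin n)))ᶜ a b)) =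
      (prodBernoulli u).real (openConn a₀ b ∩
        {ω : BondConfig (Fin n) | ∀ a ∈ ({b, a₀} : Finset (Fin n)), ω ∉ ⋃ x ∈ S, openConn x a}) := by
  rw [← blockPocket_sum_dead u S {b, a₀} (openConn a₀ b)]
  refine Finset.sum_congr rfl fun W hW => ?_
  have hWd : Disjoint W ({b, a₀} : Finset (Fin n)) := (Finset.mem_filter.1 hW).2
  have ha₀W : a₀ ∉ W := fun h => Finset.disjoint_left.1 hWd h (by simp)
  rw [ratioOneRelay_inf'_pair u b a₀ W hWd hb, blockPocket_mul_offConn u S W hS a₀ b ha₀W]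

/-- The point's dead-pocket mass at one relay is the losing mass:
`Σ_{W ∋ s, W ∩ {b,a₀} = ∅} μ(C(s) = W) · inf' = μ(a₀ ↔ b, s ↮ b, s ↮ a₀)`. [folklore; KozmaNitzan2024 §3.2 p. 14] -/
theorem ratioOneRelay_pointPockets_eq (u : Sym2 (Fin n) → unitInterval) (s b a₀ : Fin n)
    (hsb : s ≠ b) (hsa : s ≠ a₀) (hb : b ∈ ({b, a₀} : Finset (Fin n))) :
    ∑ W ∈ (Finset.univ : Finset (Finset (Fin n))).filter (fun W => s ∈ W ∧ Disjoint W ({b, a₀} : Finset (Fin n))),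
        (prodBernoulli u).real {ω : BondConfig (Fin n) | openCluster ω s = (W : Set (Fin n))}
          * ({b, a₀} : Finset (Fin n)).inf' ⟨b, hb⟩
              (fun a => (prodBernoulli u).real (openConnIn ((W : Set (Fin n)))ᶜ a b)) =
      (prodBernoulli u).real (openConn a₀ b ∩ (openConn s b)ᶜ ∩ (openConn s a₀)ᶜ) := by
  rw [← offObs_sum_fib_inter u s (openConn a₀ b ∩ (openConn s b)ᶜ ∩ (openConn s a₀)ᶜ), Finset.sum_filter]
  refine Finset.sum_congr rfl fun W _ => ?_
  by_cases hW : s ∈ W ∧ Disjoint W ({b, a₀} : Finset (Fin n))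
  · rw [if_pos hW]
    have hbW : b ∉ W := fun h => Finset.disjoint_left.1 hW.2 h (Finset.mem_insert_self b _)
    have ha₀W : a₀ ∉ W := fun h => Finset.disjoint_left.1 hW.2 h (by simp)
    rw [ratioOneRelay_inf'_pair u b a₀ W hW.2 hb, ← stub_goodStep_var1359 n u W s a₀ b hW.1 ha₀W hbW]
    congr 1
    ext ω
    simp only [Set.mem_inter_iff, Set.mem_setOf_eq, Set.mem_compl_iff]
    constructor
    · rintro ⟨hC, hab⟩
      refine ⟨hC, ⟨hab, fun hsb' => hbW ?_⟩, fun hsa' => ha₀W ?_⟩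
      · exact Finset.mem_coe.1 (hC ▸ (show b ∈ openCluster ω s from hsb'))
      · exact Finset.mem_coe.1 (hC ▸ (show a₀ ∈ openCluster ω s from hsa'))
    · rintro ⟨hC, ⟨hab, -⟩, -⟩
      exact ⟨hC, hab⟩
  · rw [if_neg hW]
    symm
    -- the fibre meets the event only for admissible `W`: the intersection is empty
    have hempty : {ω : BondConfig (Fin n) | openCluster ω s = (W : Set (Fin n))} ∩
        (openConn a₀ b ∩ (openConn s b)ᶜ ∩ (openConn s a₀)ᶜ) = ∅ := by
      ext ω
      simp only [Set.mem_inter_iff, Set.mem_setOf_eq, Set.mem_compl_iff, Set.mem_empty_iff_false, iff_false,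
        not_and, not_not]
      intro hC hab
      by_contra hsa'
      apply hW
      refine ⟨?_, Finset.disjoint_left.2 fun z hz hzA => ?_⟩
      · rw [← Finset.mem_coe, ← hC]
        exact (SimpleGraph.Reachable.refl s : (openGraph ω).Reachable s s)
      · have hz' : z ∈ openCluster ω s := by rw [hC]; exact Finset.mem_coe.2 hz
        rcases Finset.mem_insert.1 hzA with rfl | hz2
        · exact hab.2 hz'
        · rw [Finset.mem_singleton] at hz2
          subst hz2
          exact hsa' hz'
    rw [hempty, measureReal_empty]

/-- **The line's stub `stub_ratioMonotonePair` at ONE relay**, in its exact syntax: for `A = {b, a₀}`, a 2-block `S ∋ s`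
disjoint from `A`, `K(s)·Z(S) ≤ K(S)·Z(s)` — no minimiser or badness hypothesis is needed at one relay.  Proof: the dead-pocket
masses are the losing masses (`ratioOneRelay_pointPockets_eq`, `ratioOneRelay_blockPockets_eq`), the slacks are the winning masses
(event bookkeeping), and the inequality is `ratioOneRelay_odds`.
[cite: KozmaNitzan2024, §3.2 pp. 12–14; VandenbergHaggstromKahn2005, Thms. 1.3–1.4 (pp. 6–7)] -/
theorem ratioMonotonePair_oneRelay (u : Sym2 (Fin n) → unitInterval) (S : Finset (Fin n)) (b a₀ s : Fin n)
    (hb : b ∈ ({b, a₀} : Finset (Fin n))) (hSA : Disjoint S ({b, a₀} : Finset (Fin n)))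
    (hs : s ∈ S) (h2 : S.card = 2) :
    ((prodBernoulli u).real (openConn s b)
        + (∑ W ∈ (Finset.univ : Finset (Finset (Fin n))).filter
              (fun W => s ∈ W ∧ Disjoint W ({b, a₀} : Finset (Fin n))),
            (prodBernoulli u).real {ω : BondConfig (Fin n) | openCluster ω s = (W : Set (Fin n))}
              * ({b, a₀} : Finset (Fin n)).inf' ⟨b, hb⟩
                  (fun a => (prodBernoulli u).real (openConnIn ((W : Set (Fin n)))ᶜ a b)))
        - (prodBernoulli u).real (openConn a₀ b))
      * (∑ W ∈ (Finset.univ : Finset (Finset (Fin n))).filter (fun W => Disjoint W ({b, a₀} : Finset (Fin n))),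
            (prodBernoulli u).real
                {ω : BondConfig (Fin n) | ∀ z : Fin n, (z ∈ W ↔ ω ∈ ⋃ v ∈ S, openConn v z)}
              * ({b, a₀} : Finset (Fin n)).inf' ⟨b, hb⟩
                  (fun a => (prodBernoulli u).real (openConnIn ((W : Set (Fin n)))ᶜ a b)))
    ≤ ((prodBernoulli u).real (⋃ v ∈ S, openConn v b)
        + (∑ W ∈ (Finset.univ : Finset (Finset (Fin n))).filter (fun W => Disjoint W ({b, a₀} : Finset (Fin n))),
            (prodBernoulli u).real
                {ω : BondConfig (Fin n) | ∀ z : Fin n, (z ∈ W ↔ ω ∈ ⋃ v ∈ S, openConn v z)}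
              * ({b, a₀} : Finset (Fin n)).inf' ⟨b, hb⟩
                  (fun a => (prodBernoulli u).real (openConnIn ((W : Set (Fin n)))ᶜ a b)))
        - (prodBernoulli u).real (openConn a₀ b)
        - (prodBernoulli u).real
            ((openConn a₀ b)ᶜ ∩ (⋃ v ∈ S, openConn a₀ v) ∩ (⋃ v ∈ S, openConn v b)))
      * (∑ W ∈ (Finset.univ : Finset (Finset (Fin n))).filter
            (fun W => s ∈ W ∧ Disjoint W ({b, a₀} : Finset (Fin n))),
          (prodBernoulli u).real {ω : BondConfig (Fin n) | openCluster ω s = (W : Set (Fin n))}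
            * ({b, a₀} : Finset (Fin n)).inf' ⟨b, hb⟩
                (fun a => (prodBernoulli u).real (openConnIn ((W : Set (Fin n)))ᶜ a b))) := by
  -- the block is `{s, v}`
  obtain ⟨v, hvs, rfl⟩ : ∃ v : Fin n, v ≠ s ∧ S = {s, v} := by
    obtain ⟨x, y, hxy, rfl⟩ := Finset.card_eq_two.1 h2
    rcases Finset.mem_insert.1 hs with rfl | hsy
    · exact ⟨y, Ne.symm hxy, rfl⟩
    · rw [Finset.mem_singleton] at hsy
      subst hsy
      exact ⟨x, hxy, Finset.pair_comm x s⟩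
  have hsb : s ≠ b := fun h => Finset.disjoint_left.1 hSA hs (by simp [h])
  have hsa : s ≠ a₀ := fun h => Finset.disjoint_left.1 hSA hs (by simp [h])
  have hvb : v ≠ b := fun h => Finset.disjoint_left.1 hSA (by simp : v ∈ ({s, v} : Finset (Fin n))) (by simp [h])
  have hva : v ≠ a₀ := fun h => Finset.disjoint_left.1 hSA (by simp : v ∈ ({s, v} : Finset (Fin n))) (by simp [h])
  -- pockets = losing masses
  rw [ratioOneRelay_pointPockets_eq u s b a₀ hsb hsa hb,
    ratioOneRelay_blockPockets_eq u {s, v} ⟨s, Finset.mem_insert_self s _⟩ b a₀ hb]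
  -- the unions over the block
  have hU : (⋃ x ∈ ({s, v} : Finset (Fin n)), (openConn x b : Set (BondConfig (Fin n)))) = openConn s b ∪ openConn v b := by
    rw [Finset.set_biUnion_insert, Finset.set_biUnion_singleton]
  have hX : (⋃ x ∈ ({s, v} : Finset (Fin n)), (openConn a₀ x : Set (BondConfig (Fin n)))) = openConn a₀ s ∪ openConn a₀ v := by
    rw [Finset.set_biUnion_insert, Finset.set_biUnion_singleton]
  rw [hU, hX]
  -- the two losing events, simplified
  have hLpt : (openConn a₀ b : Set (BondConfig (Fin n))) ∩ (openConn s b)ᶜ ∩ (openConn s a₀)ᶜ =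
      openConn a₀ b ∩ (openConn s b)ᶜ := by
    ext ω
    simp only [Set.mem_inter_iff, Set.mem_compl_iff]
    constructor
    · rintro ⟨⟨hab, hsb'⟩, -⟩; exact ⟨hab, hsb'⟩
    · rintro ⟨hab, hsb'⟩
      exact ⟨⟨hab, hsb'⟩, fun hsa' => hsb' ((show (openGraph ω).Reachable s a₀ from hsa').trans hab)⟩
  have hLblk : (openConn a₀ b : Set (BondConfig (Fin n))) ∩
      {ω : BondConfig (Fin n) | ∀ a ∈ ({b, a₀} : Finset (Fin n)), ω ∉ ⋃ x ∈ ({s, v} : Finset (Fin n)), openConn x a} =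
      openConn a₀ b ∩ (openConn s b)ᶜ ∩ (openConn v b)ᶜ := by
    ext ω
    simp only [Set.mem_inter_iff, Set.mem_compl_iff, Set.mem_setOf_eq, Finset.mem_insert, Finset.mem_singleton,
      Set.mem_iUnion, exists_prop, not_exists, not_and, forall_eq_or_imp, forall_eq]
    constructor
    · rintro ⟨hab, ⟨hsb', hvb'⟩, -⟩
      exact ⟨⟨hab, hsb'⟩, hvb'⟩
    · rintro ⟨⟨hab, hsb'⟩, hvb'⟩
      exact ⟨hab, ⟨hsb', hvb'⟩,
        ⟨fun hsa' => hsb' ((show (openGraph ω).Reachable s a₀ from hsa').trans hab),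
         fun hva' => hvb' ((show (openGraph ω).Reachable v a₀ from hva').trans hab)⟩⟩
  rw [hLpt, hLblk]
  -- names
  set μ' := prodBernoulli u with hμ'
  set Psb := μ'.real (openConn s b) with hPsb
  set Pab := μ'.real (openConn a₀ b) with hPab
  set Lpt := μ'.real (openConn a₀ b ∩ (openConn s b)ᶜ) with hLptd
  set Lblk := μ'.real (openConn a₀ b ∩ (openConn s b)ᶜ ∩ (openConn v b)ᶜ) with hLblkd
  set PU := μ'.real (openConn s b ∪ openConn v b) with hPU
  set G := μ'.real ((openConn a₀ b)ᶜ ∩ (openConn a₀ s ∪ openConn a₀ v) ∩ (openConn s b ∪ openConn v b)) with hG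
  set Wpt := μ'.real (openConn s b ∩ (openConn a₀ s)ᶜ) with hWpt
  set Wblk := μ'.real ((openConn s b ∪ openConn v b) ∩ (openConn a₀ s)ᶜ ∩ (openConn a₀ v)ᶜ) with hWblk
  -- K(s) = WIN(s)
  have hKpt : Psb + Lpt - Pab = Wpt := by
    have h1 := measureReal_inter_add_sdiff (μ := μ') (s := (openConn a₀ b : Set (BondConfig (Fin n))))
      (MeasurableSet.of_discrete (s := (openConn s b : Set (BondConfig (Fin n)))))
    have h2 := measureReal_inter_add_sdiff (μ := μ') (s := (openConn s b : Set (BondConfig (Fin n))))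
      (MeasurableSet.of_discrete (s := (openConn a₀ b : Set (BondConfig (Fin n)))))
    have e1 : (openConn a₀ b : Set (BondConfig (Fin n))) \ openConn s b = openConn a₀ b ∩ (openConn s b)ᶜ := rfl
    have e2 : (openConn s b : Set (BondConfig (Fin n))) \ openConn a₀ b = openConn s b ∩ (openConn a₀ s)ᶜ := by
      ext ω
      simp only [Set.mem_sdiff, Set.mem_inter_iff, Set.mem_compl_iff]
      constructor
      · rintro ⟨hsb', hab⟩
        exact ⟨hsb', fun has' => hab ((show (openGraph ω).Reachable a₀ s from has').trans hsb')⟩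
      · rintro ⟨hsb', has'⟩
        exact ⟨hsb', fun hab => has' ((show (openGraph ω).Reachable a₀ b from hab).trans
          (SimpleGraph.Reachable.symm hsb'))⟩
    have e3 : (openConn s b : Set (BondConfig (Fin n))) ∩ openConn a₀ b = openConn a₀ b ∩ openConn s b := Set.inter_comm _ _
    rw [e1] at h1
    rw [e2, e3] at h2
    linarith
  -- K(S) = WIN(S)
  have hKblk : PU + Lblk - Pab - G = Wblk := by
    have h1 := measureReal_inter_add_sdiff (μ := μ') (s := (openConn a₀ b : Set (BondConfig (Fin n))))
      (MeasurableSet.of_discrete (s := (openConn s b ∪ openConn v b : Set (BondConfig (Fin n)))))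
    have h2 := measureReal_inter_add_sdiff (μ := μ') (s := (openConn s b ∪ openConn v b : Set (BondConfig (Fin n))))
      (MeasurableSet.of_discrete (s := (openConn a₀ b : Set (BondConfig (Fin n)))))
    have h3 := measureReal_inter_add_sdiff (μ := μ')
      (s := ((openConn s b ∪ openConn v b : Set (BondConfig (Fin n))) \ openConn a₀ b))
      (MeasurableSet.of_discrete (s := (openConn a₀ s ∪ openConn a₀ v : Set (BondConfig (Fin n)))))
    have e1 : (openConn a₀ b : Set (BondConfig (Fin n))) \ (openConn s b ∪ openConn v b) =
        openConn a₀ b ∩ (openConn s b)ᶜ ∩ (openConn v b)ᶜ := by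
      rw [Set.sdiff_eq, Set.compl_union, Set.inter_assoc]
    have e2 : (openConn s b ∪ openConn v b : Set (BondConfig (Fin n))) ∩ openConn a₀ b =
        openConn a₀ b ∩ (openConn s b ∪ openConn v b) := Set.inter_comm _ _
    have e3 : ((openConn s b ∪ openConn v b : Set (BondConfig (Fin n))) \ openConn a₀ b) ∩ (openConn a₀ s ∪ openConn a₀ v) =
        (openConn a₀ b)ᶜ ∩ (openConn a₀ s ∪ openConn a₀ v) ∩ (openConn s b ∪ openConn v b) := by
      ext ω
      simp only [Set.mem_inter_iff, Set.mem_sdiff, Set.mem_compl_iff]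
      tauto
    have e4 : ((openConn s b ∪ openConn v b : Set (BondConfig (Fin n))) \ openConn a₀ b) \ (openConn a₀ s ∪ openConn a₀ v) =
        (openConn s b ∪ openConn v b) ∩ (openConn a₀ s)ᶜ ∩ (openConn a₀ v)ᶜ := by
      ext ω
      simp only [Set.mem_inter_iff, Set.mem_sdiff, Set.mem_compl_iff, Set.mem_union, not_or]
      constructor
      · rintro ⟨⟨hU', -⟩, has', hav'⟩
        exact ⟨⟨hU', has'⟩, hav'⟩
      · rintro ⟨⟨hU', has'⟩, hav'⟩
        refine ⟨⟨hU', fun hab => ?_⟩, has', hav'⟩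
        rcases hU' with hsb' | hvb'
        · exact has' (hab.trans (SimpleGraph.Reachable.symm hsb'))
        · exact hav' (hab.trans (SimpleGraph.Reachable.symm hvb'))
    rw [e1] at h1
    rw [e2] at h2
    rw [e3, e4] at h3
    linarith
  rw [hKpt, hKblk]
  have hodds := ratioOneRelay_odds u a₀ s v b (Ne.symm hsa)
  rw [← hμ'] at hodds
  -- `hodds : Wpt * Lblk ≤ Wblk * Lpt` up to the names
  exact hodds

end RatioOneRelay

end

end Summit.CriticalPhenomena.PercolationContinuityZ3.Theorems
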